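import Literature.AnabelianGeometry.AbsoluteAnabelian.AbsTopIProp23iGFGSurfaceModel
import Literature.AnabelianGeometry.AbsoluteAnabelian.AbsTopIProp23iiAlmostProSigmaModel
import Literature.AnabelianGeometry.SemiGraphs.ProSigmaSurfaceCharacters
import HarnessLib

/-!
# [AbsTopI] Prop 2.2 / 2.3 (i)(ii) for extensions `1 → Δ → Π → G → 1` whose `Δ` IS the GFG construction

S. Mochizuki, *Topics in Absolute Anabelian Geometry I: Generalities* (2012) [AbsTopI] (lit key
`paper:url-11ac98ba15fc`), Def 2.1 (i)(ii) p. 17, Prop 2.2 p. 18, Prop 2.3 (i)(ii) p. 19.  PROOF-ONLY packaging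
(no definition, no named fact): abc-iut-w6-d071's `FundamentalExtension.prop22_prop23_of_isOpen_proSigma_hyperbolic_mlf`
/ `_nf` (`AbsTopIProp23iiAlmostProSigmaModel.lean`, p436367) prove the three node predicates `E.GeomTFG`,
`E.GeomSlimElastic`, `E.ArithSlimNotElastic` for `Δ = E.geom` containing an OPEN pro-`Σ` surface completion,
MODULO (FN) «`Δ` has no nontrivial finite normal subgroup».  When `Δ` is presented as the GFG construction of
Def 2.1 (i) (proper case: `π : P ↠ Δ` from a pro-`Σ′` completion `j : Γ → P` of `Γ ≅ S_g`, `g ≥ 2`, `U ⊴ P` open,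
`ker π ≤ U`, `π|_U` presenting the maximal pro-`Σ` quotient), (FN) is the THEOREM
`GFGSurfaceModel.forall_finite_normal_eq_bot` (p440186), so the three predicates hold outright:
`prop22_prop23_gfg_mlf`, `prop22_prop23_gfg_nf`, and `geomSlimElastic_gfg` (any base).

HONEST SCOPE: model-level (proper curves, Riemann-existence presentation); `Σ` a set of primes containing a
prime.  Classical; OUR kernel check; nothing here bears on [IUTchIII] Cor. 3.12.
-/

noncomputable section

open Topology

namespace Literature.AnabelianGeometry.AbsoluteAnabelian

namespace FundamentalExtension

open Literature.AlgebraicGeometry.Frobenioids (IsSlimGroup)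
open Literature.AnabelianGeometry.SemiGraphs.PSCDatum (IsMaxProSigmaQuotient)
open Literature.AnabelianGeometry.SemiGraphs.SemiGraphOfAnabelioids
open Literature.AnabelianGeometry.SemiGraphs.SemiGraphOfAnabelioids.IsProSigmaCompletion
open Literature.GroupTheory.CombinatorialGroupTheory
open Literature.GroupTheory.ProfiniteSubquotients
open Literature.Topology.FourManifolds (SurfaceGroup)

variable {E : FundamentalExtension.{0}} {Sigma Sigma' : Set ℕ} {Γ : Type} [Group Γ]
  {P : Type} [Group P] [TopologicalSpace P] [IsTopologicalGroup P] [CompactSpace P]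
  [TotallyDisconnectedSpace P] {j : Γ →* P} {π : P →* E.geom} {U : Subgroup P}

/-- At the GFG construction, the open subgroup `π(U) ⊆ Δ = E.geom` is presented as a pro-`Σ` completion of a
closed surface group `Γ_{g′,0}`, `g′ = [P : U](g − 1) + 1 ≥ 2` (F_cov + `Γ_{g′,0} ≅ S_{g′}`).
[cite: MochizukiAbsTopI2012, Def 2.1 (i) p.17] -/
theorem exists_puncturedSurfaceGroup_completion_gfg (hSS : Sigma ⊆ Sigma') {g : ℕ} (hg : 2 ≤ g)
    (e : Γ ≃* SurfaceGroup g) (hj : IsProSigmaCompletion Sigma' j) (hUo : IsOpen (U : Set P))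
    (hπc : Continuous π) (hmax : IsMaxProSigmaQuotient Sigma (π.subgroupMap U)) :
    ∃ (g' : ℕ) (ι : PuncturedSurfaceGroup g' 0 →* (U.map π : Subgroup E.geom)),
      2 ≤ g' ∧ IsProSigmaCompletion Sigma ι := by
  haveI : CompactSpace E.geom := isCompact_iff_compactSpace.mp E.isClosed_geom.isCompact
  haveI : (U.comap j).FiniteIndex := finiteIndex_comap hj U hUo
  obtain ⟨g', hg'eq, ⟨eU⟩⟩ := GFGSurfaceModel.exists_mulEquiv_surfaceGroup_of_finiteIndex hg e (U.comap j)
  have hg'2 : 2 ≤ g' := two_le_genus_of_index hg Subgroup.FiniteIndex.index_ne_zero hg'eq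
  obtain ⟨e0⟩ := nonempty_mulEquiv_puncturedSurfaceGroup_zero g'
  have hιU := GFGSurfaceModel.isProSigmaCompletion_map hSS hj hUo hπc hmax
  -- transport along `Γ_{g′,0} ≅ S_{g′} ≅ j⁻¹U`
  let e' : PuncturedSurfaceGroup g' 0 ≃* (U.comap j) := e0.trans eU.symm
  refine ⟨g', ((π.subgroupMap U).comp (j.subgroupComap U)).comp e'.toMonoidHom, hg'2, ?_⟩
  exact hιU.of_comp_mulEquiv e' (fun _ => rfl)

/-- **[AbsTopI] Prop 2.3 (i) `E.GeomSlimElastic` at the GFG construction** (any base `G`): `Δ = E.geom` the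
Def 2.1 (i) quotient (proper case) is slim and elastic — `GFGSurfaceModel.slim_and_elastic` (p440186).
[cite: MochizukiAbsTopI2012, Prop 2.3 (i) p.19] -/
theorem geomSlimElastic_gfg (hSS : Sigma ⊆ Sigma') (hS : ∃ ℓ ∈ Sigma, ℓ.Prime) {g : ℕ} (hg : 2 ≤ g)
    (e : Γ ≃* SurfaceGroup g) (hj : IsProSigmaCompletion Sigma' j) [U.Normal] (hUo : IsOpen (U : Set P))
    (hπc : Continuous π) (hπs : Function.Surjective π) (hker : π.ker ≤ U)
    (hmax : IsMaxProSigmaQuotient Sigma (π.subgroupMap U)) : E.GeomSlimElastic := by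
  haveI : CompactSpace E.geom := isCompact_iff_compactSpace.mp E.isClosed_geom.isCompact
  exact GFGSurfaceModel.slim_and_elastic hSS hS hg e hj hUo hπc hπs hker hmax

/-- **[AbsTopI] Prop 2.2 + Prop 2.3 (i) + Prop 2.3 (ii) at the GFG construction, MLF base**: for an extension
`1 → Δ → Π → G → 1` with MLF base data whose `Δ` is the Def 2.1 (i) quotient (proper case), `Δ` is t.f.g., slim
and elastic, and `Π` is slim but not elastic — w6-d071's p436367 with (FN) := `forall_finite_normal_eq_bot`.
[cite: MochizukiAbsTopI2012, Prop 2.3 p.19] -/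
theorem prop22_prop23_gfg_mlf (B : E.MLFBase) (hSS : Sigma ⊆ Sigma') (hS : ∃ ℓ ∈ Sigma, ℓ.Prime)
    (hSp : ∀ p ∈ Sigma, p.Prime) {g : ℕ} (hg : 2 ≤ g) (e : Γ ≃* SurfaceGroup g)
    (hj : IsProSigmaCompletion Sigma' j) [U.Normal] (hUo : IsOpen (U : Set P)) (hπc : Continuous π)
    (hπs : Function.Surjective π) (hker : π.ker ≤ U) (hmax : IsMaxProSigmaQuotient Sigma (π.subgroupMap U)) :
    E.GeomTFG ∧ E.GeomSlimElastic ∧ E.ArithSlimNotElastic := by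
  haveI : CompactSpace E.geom := isCompact_iff_compactSpace.mp E.isClosed_geom.isCompact
  obtain ⟨g', ι, hg'2, hι⟩ := exists_puncturedSurfaceGroup_completion_gfg hSS hg e hj hUo hπc hmax
  have hgr : PuncturedSurfaceGroup.IsHyperbolicType g' 0 := by
    unfold PuncturedSurfaceGroup.IsHyperbolicType; omega
  have hfin := GFGSurfaceModel.forall_finite_normal_eq_bot hSS hS hg e hj hUo hπc hπs hker hmax
  obtain ⟨ℓ, hℓS, _⟩ := hS
  exact prop22_prop23_of_isOpen_proSigma_hyperbolic_mlf B ⟨ℓ, hℓS⟩ hSp hgr (U.map π)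
    (GFGSurfaceModel.isOpen_map hUo hπc hπs hker) ι hι hfin

/-- **The same, NF base.** [cite: MochizukiAbsTopI2012, Prop 2.3 p.19] -/
theorem prop22_prop23_gfg_nf (B : E.NFBase) (hSS : Sigma ⊆ Sigma') (hS : ∃ ℓ ∈ Sigma, ℓ.Prime)
    (hSp : ∀ p ∈ Sigma, p.Prime) {g : ℕ} (hg : 2 ≤ g) (e : Γ ≃* SurfaceGroup g)
    (hj : IsProSigmaCompletion Sigma' j) [U.Normal] (hUo : IsOpen (U : Set P)) (hπc : Continuous π)
    (hπs : Function.Surjective π) (hker : π.ker ≤ U) (hmax : IsMaxProSigmaQuotient Sigma (π.subgroupMap U)) :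
    E.GeomTFG ∧ E.GeomSlimElastic ∧ E.ArithSlimNotElastic := by
  haveI : CompactSpace E.geom := isCompact_iff_compactSpace.mp E.isClosed_geom.isCompact
  obtain ⟨g', ι, hg'2, hι⟩ := exists_puncturedSurfaceGroup_completion_gfg hSS hg e hj hUo hπc hmax
  have hgr : PuncturedSurfaceGroup.IsHyperbolicType g' 0 := by
    unfold PuncturedSurfaceGroup.IsHyperbolicType; omega
  have hfin := GFGSurfaceModel.forall_finite_normal_eq_bot hSS hS hg e hj hUo hπc hπs hker hmax
  obtain ⟨ℓ, hℓS, _⟩ := hS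
  exact prop22_prop23_of_isOpen_proSigma_hyperbolic_nf B ⟨ℓ, hℓS⟩ hSp hgr (U.map π)
    (GFGSurfaceModel.isOpen_map hUo hπc hπs hker) ι hι hfin

end FundamentalExtension

end Literature.AnabelianGeometry.AbsoluteAnabelian

end
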